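import Summits.CriticalPhenomena.CardyFormulaZ2.Theorems.CardyIKTransportCornerLineDescentLocality
import Summits.CriticalPhenomena.CardyFormulaZ2.Theorems.CardyIKTransportCornerLineDescentRusso
import Summits.CriticalPhenomena.CardyFormulaZ2.Theorems.CardyIKTransportCornerLineDescentSyndromeBias
import Summits.CriticalPhenomena.CardyFormulaZ2.Theorems.CardyIKTransportCornerLineDescentFreezeToStandard

/-!
# The crux `CardyIKTransport.CornerLineDescent` (stmt-CriticalPhenomena-10964) CLOSED MODULO TWO TYPED STATEMENTS:
# the sorry-free composition of the line `symmetric-seed-second-order`, landed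

Support file (`--supports stmt-CriticalPhenomena-10964`) for the line `symmetric-seed-second-order` (checked skeleton
`Cruxes/CornerLineDescent/Lines/symmetric_seed_second_order.lean`, leads 0 / c1 / c2).  Vocabulary:
`Theorems/CardyIKTransportCornerLineDescentLine.lean` (`gaugeCrossingProb`, `influenceSum`, `InfluenceBoundOn`,
`DiluteBoundOn`, `RussoLipschitzOn`, `pIK`, `cornerLineDescent_iff`).

THE THEOREM OF THIS FILE (`cornerLineDescent_of_influenceBounds`): the crux BY NAME follows from exactly two statements
about the corner-line gauge `M_p`, `p ∈ [0, p_IK]` — both typed in the vocabulary file, both the registered open stubs of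
the line, both believed true and both OPEN (they are the line's reading of CornerIrrelevance with a rate):

* (SUMMED) `∀ R, ∃ θ C c₀, 0 < θ ∧ 0 < c₀ ∧ ∀ᶠ δ, InfluenceBoundOn R θ C c₀ δ` — in the dense window `c₀ δ ≤ p ≤ p_IK`
  the unsigned Russo sum of the corner seed is second order in units of the wall-persistence length,
  `Σ_f |I_f(p)| ≤ C p⁻¹ (δ/p)^θ` (card U2; bulk rate `x > 2` from the `D₄(f) × T` selection rules, leading open channel
  six-leg `35/12`, drefute audit v3; boundary layer three half-plane arms);
* (DILUTE) `∀ R c, 0 < c → ∃ C κ, 0 < κ ∧ ∀ᶠ δ, DiluteBoundOn R c C κ δ` — in the dilute window `0 ≤ p ≤ c δ` the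
  unsigned Russo sum is `≤ C δ^{κ-1}` (signed single-dislocation size `x₀ = 1 + κ > 1` in backgrounds of `O(δ⁻¹)`
  dislocations; first order in the Burgers data cancels in law, triage r1-1 §X).

EVERYTHING ELSE ENTERS BY ITS LANDED NAME: `stub_Locality` (p80521) and `stub_Russo` (p82972) give the Margulis–Russo
mean-value inequality for the non-monotone product gauge; `stub_FreezeToStandard` (p100600 = FreezeHomogenisation p93823 ∘
CrudeContinuity p95499 ∘ `SchrammSmirnov2011_lemma_5_1_holds` p99052) carries Cardy for the frozen gauge `p = 0` (bond-`ℤ²`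
at `½` on the renewal grid) to standard bond-`ℤ²`.  The plumbing in between is the checked skeleton's §4–§5, landed here
verbatim: dyadic Russo integration over `[Kδ, p_IK]` (`dyadic_sum_bound`, `uci_of`), linear Russo integration over
`[0, Kδ]` (`regimeOne_of`), and their overlap at `p = Kδ` (`endgame_core`) — `|P_IK(R,δ) − P_0(R,δ)| → 0` for every
conformal rectangle with NO limit object and no interchange of limits; THE HYPOTHESIS OF THE CRUX (Cardy for `P_IK`,
`= gaugeCrossingProb p_IK` by `Iff.rfl`) then transfers along the vanishing difference.  The variant
`cornerLineDescent_of_registeredStubs` takes the two stubs in their REGISTERED form (the summed one with its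
`SyndromeBiasAt` antecedent, discharged by the landed `stub_SyndromeBias`, p89215).

Use: when the two statements are proved — or filed by the planner as `@[conjecture]` items of a conditional bridge —
the crux closes by `exact cornerLineDescent_of_influenceBounds h₁ h₂`.  Nothing in this file is new mathematics; it is
the line's kernel-checked bookkeeping moved from the crux workfile into the importable tree.
References: route file `Theses/CardyIKTransport.lean` (item 10964); `Cruxes/CornerLineDescent/Disproof.lean` §A, §G;
Russo, Z. Wahrsch. 56 (1981) §4; Grimmett, *Percolation* (1999) Thm 2.25.
-/

noncomputable section

namespace Summit.CriticalPhenomena.CardyFormulaZ2.Theorems.CornerLineDescent.SymmetricSeed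

open scoped Topology
open Filter Set
open Literature.Probability.RandomPlanarGeometry

/-! ## §1 Dyadic and linear Russo integration, and the overlap (the checked skeleton's §4, verbatim) -/

/-- Dyadic summation (elementary real analysis): one-octave increments bounded by the profile
`A (δ/a)^θ` telescope to `A (δ/p)^θ / (1 − 2^{−θ})`. [folklore] -/
theorem dyadic_sum_bound (G : ℝ → ℝ) (p q A θ δ : ℝ) (hp : 0 < p) (hθ : 0 < θ) (hA : 0 ≤ A)
    (hδ : 0 ≤ δ) (hpq : p ≤ q)
    (hstep : ∀ a b : ℝ, p ≤ a → a ≤ b → b ≤ q → b ≤ 2 * a → |G b - G a| ≤ A * (δ / a) ^ θ) :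
    |G q - G p| ≤ A / (1 - (1 / 2 : ℝ) ^ θ) * (δ / p) ^ θ := by
  set r : ℝ := (1 / 2 : ℝ) ^ θ with hr
  have hr0 : 0 ≤ r := Real.rpow_nonneg (by norm_num) θ
  have hr1 : r < 1 := Real.rpow_lt_one (by norm_num) (by norm_num) hθ
  have hδp : 0 ≤ δ / p := div_nonneg hδ hp.le
  -- the `k`-th octave profile
  have hoct : ∀ k : ℕ, (δ / (2 ^ k * p)) ^ θ = (δ / p) ^ θ * r ^ k := by
    intro k
    rw [hr, Real.rpow_pow_comm (by norm_num) θ k, ← Real.mul_rpow hδp (by positivity)]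
    congr 1
    rw [one_div_pow]
    field_simp
  -- telescoping along the dyadic points `2^k p`
  have aux : ∀ N : ℕ, ∀ q', p ≤ q' → q' ≤ q → q' ≤ 2 ^ N * p →
      |G q' - G p| ≤ A * (δ / p) ^ θ * ∑ k ∈ Finset.range N, r ^ k := by
    intro N
    induction N with
    | zero =>
      intro q' h1 _ h3
      have h3' : q' ≤ p := by simpa using h3
      have : q' = p := le_antisymm h3' h1
      simp [this]
    | succ N ih =>
      intro q' h1 h2 h3
      by_cases hc : q' ≤ 2 ^ N * p
      · refine (ih q' h1 h2 hc).trans ?_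
        apply mul_le_mul_of_nonneg_left _ (by positivity)
        apply Finset.sum_le_sum_of_subset_of_nonneg (Finset.range_mono (Nat.le_succ N))
        intro i _ _
        positivity
      · have hc : 2 ^ N * p < q' := lt_of_not_ge hc
        have h2N : (1:ℝ) ≤ 2 ^ N := one_le_pow₀ (by norm_num)
        have hpa : p ≤ 2 ^ N * p := le_mul_of_one_le_left hp.le h2N
        have haq : 2 ^ N * p ≤ q' := hc.le
        have hb2 : q' ≤ 2 * (2 ^ N * p) := by
          have : (2:ℝ) ^ (N + 1) * p = 2 * (2 ^ N * p) := by ring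
          rw [this] at h3; exact h3
        have step := hstep (2 ^ N * p) q' hpa haq h2 hb2
        have prev := ih (2 ^ N * p) hpa (haq.trans h2) le_rfl
        calc |G q' - G p| ≤ |G q' - G (2 ^ N * p)| + |G (2 ^ N * p) - G p| := abs_sub_le _ _ _
          _ ≤ A * (δ / (2 ^ N * p)) ^ θ + A * (δ / p) ^ θ * ∑ k ∈ Finset.range N, r ^ k :=
              add_le_add step prev
          _ = A * (δ / p) ^ θ * ∑ k ∈ Finset.range (N + 1), r ^ k := by
              rw [Finset.sum_range_succ, hoct N]; ring
  -- enough octaves to reach `q`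
  obtain ⟨N, hN⟩ : ∃ N : ℕ, q ≤ 2 ^ N * p := by
    obtain ⟨N, hN⟩ := pow_unbounded_of_one_lt (q / p) (by norm_num : (1:ℝ) < 2)
    exact ⟨N, by rw [div_lt_iff₀ hp] at hN; exact hN.le⟩
  have hgeom : ∑ k ∈ Finset.range N, r ^ k ≤ (1 - r)⁻¹ :=
    sum_le_hasSum (Finset.range N) (fun i _ => pow_nonneg hr0 i) (hasSum_geometric_of_lt_one hr0 hr1)
  calc |G q - G p| ≤ A * (δ / p) ^ θ * ∑ k ∈ Finset.range N, r ^ k := aux N q hpq le_rfl hN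
    _ ≤ A * (δ / p) ^ θ * (1 - r)⁻¹ := by
        apply mul_le_mul_of_nonneg_left hgeom (by positivity)
    _ = A / (1 - r) * (δ / p) ^ θ := by rw [div_eq_mul_inv]; ring

/-- UNIFORM CORNER IRRELEVANCE in units of `ξ_p` (the card's `UniformCornerIrrelevance`, here DERIVED):
Russo in mean-value form + the summed influence bound, integrated dyadically in `p`, give
`|P_{p_IK}(R,δ) − P_p(R,δ)| ≤ C' (δ/p)^θ` for `c₀ δ ≤ p ≤ p_IK`, eventually in `δ`. [folklore] -/
theorem uci_of
    (hrusso : ∀ (R : ConformalRectangle) (δ : ℝ), 0 < δ → ∀ p₁ p₂ M : ℝ, 0 ≤ p₁ → p₁ ≤ p₂ → p₂ ≤ 1 →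
      RussoLipschitzOn R δ p₁ p₂ M)
    (hsum : ∀ R : ConformalRectangle, ∃ θ C c₀ : ℝ, 0 < θ ∧ 0 < c₀ ∧
      ∀ᶠ δ in 𝓝[>] (0:ℝ), InfluenceBoundOn R θ C c₀ δ)
    (R : ConformalRectangle) :
    ∃ θ C c₀ : ℝ, 0 < θ ∧ 0 < c₀ ∧ ∀ᶠ δ in 𝓝[>] (0:ℝ), ∀ p : ℝ, c₀ * δ ≤ p → p ≤ pIK →
      |gaugeCrossingProb pIK R δ - gaugeCrossingProb p R δ| ≤ C * (δ / p) ^ θ := by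
  obtain ⟨θ, C, c₀, hθ, hc₀, hev⟩ := hsum R
  set C' : ℝ := max C 0 with hC'
  have hC'0 : 0 ≤ C' := le_max_right _ _
  refine ⟨θ, C' / (1 - (1 / 2 : ℝ) ^ θ), c₀, hθ, hc₀, ?_⟩
  have hpos : ∀ᶠ δ in 𝓝[>] (0:ℝ), δ ∈ Set.Ioi (0:ℝ) := eventually_mem_nhdsWithin
  filter_upwards [hev, hpos] with δ hδB hδ
  have hδ : 0 < δ := hδ
  intro p hp1 hp2
  have hp : 0 < p := lt_of_lt_of_le (mul_pos hc₀ hδ) hp1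
  -- one octave: Russo with the monotone majorant `C' a⁻¹ (δ/a)^θ`
  have hstep : ∀ a b : ℝ, p ≤ a → a ≤ b → b ≤ pIK → b ≤ 2 * a →
      |gaugeCrossingProb b R δ - gaugeCrossingProb a R δ| ≤ C' * (δ / a) ^ θ := by
    intro a b hpa hab hbq hb2
    have ha : 0 < a := hp.trans_le hpa
    set M : ℝ := C' * a⁻¹ * (δ / a) ^ θ with hM
    have hMnn : 0 ≤ M := by positivity
    have hbound : ∀ s : ℝ, a ≤ s → s ≤ b → influenceSum s R δ ≤ M := by
      intro s has hsb
      have hs : 0 < s := ha.trans_le has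
      have h0 := hδB s (hp1.trans (hpa.trans has)) (hsb.trans hbq)
      have hX1 : s⁻¹ ≤ a⁻¹ := inv_anti₀ ha has
      have hX2 : (δ / s) ^ θ ≤ (δ / a) ^ θ :=
        Real.rpow_le_rpow (by positivity) (div_le_div_of_nonneg_left hδ.le ha has) hθ.le
      calc influenceSum s R δ ≤ C * s⁻¹ * (δ / s) ^ θ := h0
        _ ≤ C' * s⁻¹ * (δ / s) ^ θ := by
            apply mul_le_mul_of_nonneg_right _ (by positivity)
            exact mul_le_mul_of_nonneg_right (le_max_left _ _) (by positivity)
        _ ≤ C' * a⁻¹ * (δ / a) ^ θ := by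
            apply mul_le_mul (mul_le_mul_of_nonneg_left hX1 hC'0) hX2 (by positivity) (by positivity)
    have hr := hrusso R δ hδ a b M ha.le hab (hbq.trans pIK_le_one) hbound
    calc |gaugeCrossingProb b R δ - gaugeCrossingProb a R δ| ≤ M * (b - a) := hr
      _ ≤ M * a := by apply mul_le_mul_of_nonneg_left _ hMnn; linarith
      _ = C' * (δ / a) ^ θ := by rw [hM]; field_simp
  have key := dyadic_sum_bound (fun s => gaugeCrossingProb s R δ) p pIK C' θ δ hp hθ hC'0 hδ.le hp2 hstep
  simpa using key

/-- REGIME ONE (the card's `RegimeOne`, here DERIVED): Russo in mean-value form + the dilute influence bound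
give, for every window constant `c`, `|P_p(R,δ) − P_0(R,δ)| ≤ ε` for all `p ≤ c δ`, eventually in `δ`. [folklore] -/
theorem regimeOne_of
    (hrusso : ∀ (R : ConformalRectangle) (δ : ℝ), 0 < δ → ∀ p₁ p₂ M : ℝ, 0 ≤ p₁ → p₁ ≤ p₂ → p₂ ≤ 1 →
      RussoLipschitzOn R δ p₁ p₂ M)
    (hdil : ∀ (R : ConformalRectangle) (c : ℝ), 0 < c → ∃ C κ : ℝ, 0 < κ ∧
      ∀ᶠ δ in 𝓝[>] (0:ℝ), DiluteBoundOn R c C κ δ)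
    (R : ConformalRectangle) (ε : ℝ) (hε : 0 < ε) (c : ℝ) (hc : 0 < c) :
    ∀ᶠ δ in 𝓝[>] (0:ℝ), ∀ p : ℝ, 0 ≤ p → p ≤ c * δ →
      |gaugeCrossingProb p R δ - gaugeCrossingProb 0 R δ| ≤ ε := by
  obtain ⟨C, κ, hκ, hev⟩ := hdil R c hc
  set C' : ℝ := max C 0 with hC'
  have hC'0 : 0 ≤ C' := le_max_right _ _
  have h1 : ∀ᶠ δ in 𝓝[>] (0:ℝ), C' * c * δ ^ κ ≤ ε := by
    have h0 : Tendsto (fun δ : ℝ => δ ^ κ) (𝓝[>] (0:ℝ)) (𝓝 0) := by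
      have hcont := (Real.continuousAt_rpow_const 0 κ (Or.inr hκ.le)).tendsto
      rw [Real.zero_rpow hκ.ne'] at hcont
      exact hcont.mono_left nhdsWithin_le_nhds
    have ht : Tendsto (fun δ : ℝ => C' * c * δ ^ κ) (𝓝[>] (0:ℝ)) (𝓝 0) := by
      simpa using h0.const_mul (C' * c)
    exact ht.eventually_le_const hε
  have h2 : ∀ᶠ δ in 𝓝[>] (0:ℝ), c * δ ≤ 1 := by
    have ht : Tendsto (fun δ : ℝ => c * δ) (𝓝[>] (0:ℝ)) (𝓝 0) := by
      have h0 : Tendsto (fun δ : ℝ => c * δ) (𝓝 (0:ℝ)) (𝓝 (c * 0)) :=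
        tendsto_const_nhds.mul tendsto_id
      rw [mul_zero] at h0
      exact h0.mono_left nhdsWithin_le_nhds
    exact ht.eventually_le_const one_pos
  have h3 : ∀ᶠ δ in 𝓝[>] (0:ℝ), δ ∈ Set.Ioi (0:ℝ) := eventually_mem_nhdsWithin
  filter_upwards [hev, h1, h2, h3] with δ hD hε' hcδ hδ
  have hδ : 0 < δ := hδ
  intro p hp0 hpc
  have hM : ∀ s : ℝ, 0 ≤ s → s ≤ p → influenceSum s R δ ≤ C' * δ ^ (κ - 1) := fun s hs0 hsp =>
    (hD s hs0 (hsp.trans hpc)).trans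
      (mul_le_mul_of_nonneg_right (le_max_left _ _) (Real.rpow_nonneg hδ.le _))
  have hr := hrusso R δ hδ 0 p (C' * δ ^ (κ - 1)) le_rfl hp0 (hpc.trans hcδ) hM
  rw [sub_zero] at hr
  have hpow : δ ^ κ = δ ^ (κ - 1) * δ := by
    rw [Real.rpow_sub_one hδ.ne', div_mul_cancel₀ _ hδ.ne']
  calc |gaugeCrossingProb p R δ - gaugeCrossingProb 0 R δ| ≤ C' * δ ^ (κ - 1) * p := hr
    _ ≤ C' * δ ^ (κ - 1) * (c * δ) := by
        apply mul_le_mul_of_nonneg_left hpc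
        exact mul_nonneg hC'0 (Real.rpow_nonneg hδ.le _)
    _ = C' * c * δ ^ κ := by rw [hpow]; ring
    _ ≤ ε := hε'

/-- THE OVERLAP (the card's `endgame_core`, logic only): Regime One and uniform corner irrelevance in units of
`ξ_p` meet at `p = K δ` — take `K ≥ c₀` with `C K^{−θ} ≤ ε/2` — so the isotropic-IK gauge model and the
renewal-grid bond model `p = 0` have the same crude crossing probabilities up to `o(1)`, for every conformal
rectangle: NO limit object, no `t → 0⁺` interchange of limits. [folklore] -/
theorem endgame_core
    (h1 : ∀ (R : ConformalRectangle) (ε : ℝ), 0 < ε → ∀ c : ℝ, 0 < c →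
      ∀ᶠ δ in 𝓝[>] (0:ℝ), ∀ p : ℝ, 0 ≤ p → p ≤ c * δ →
        |gaugeCrossingProb p R δ - gaugeCrossingProb 0 R δ| ≤ ε)
    (h2 : ∀ R : ConformalRectangle, ∃ θ C c₀ : ℝ, 0 < θ ∧ 0 < c₀ ∧
      ∀ᶠ δ in 𝓝[>] (0:ℝ), ∀ p : ℝ, c₀ * δ ≤ p → p ≤ pIK →
        |gaugeCrossingProb pIK R δ - gaugeCrossingProb p R δ| ≤ C * (δ / p) ^ θ)
    (R : ConformalRectangle) (ε : ℝ) (hε : 0 < ε) :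
    ∀ᶠ δ in 𝓝[>] (0:ℝ), |gaugeCrossingProb pIK R δ - gaugeCrossingProb 0 R δ| ≤ ε := by
  obtain ⟨θ, C, c₀, hθ, hc₀, hev2⟩ := h2 R
  -- window constant `K ≥ c₀` with `C (1/K)^θ ≤ ε/2`
  set M : ℝ := max (2 * C / ε) 1 with hM
  have hM1 : 1 ≤ M := le_max_right _ _
  have hMpos : 0 < M := lt_of_lt_of_le one_pos hM1
  set K₁ : ℝ := M ^ (1 / θ) with hK₁
  have hK₁pos : 0 < K₁ := Real.rpow_pos_of_pos hMpos _
  set K : ℝ := max c₀ K₁ with hK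
  have hKpos : 0 < K := lt_of_lt_of_le hc₀ (le_max_left _ _)
  have hK₁le : K₁ ≤ K := le_max_right _ _
  have hc₀le : c₀ ≤ K := le_max_left _ _
  have hKθ : (1 / K) ^ θ ≤ 1 / M := by
    have h1' : (1 / K) ^ θ ≤ (1 / K₁) ^ θ := by
      apply Real.rpow_le_rpow (by positivity)
      · exact one_div_le_one_div_of_le hK₁pos hK₁le
      · exact hθ.le
    have h2' : (1 / K₁) ^ θ = 1 / M := by
      rw [Real.div_rpow zero_le_one hK₁pos.le, Real.one_rpow, hK₁, ← Real.rpow_mul hMpos.le,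
        one_div_mul_cancel hθ.ne', Real.rpow_one]
    exact h1'.trans h2'.le
  have hCK : C * (1 / K) ^ θ ≤ ε / 2 := by
    by_cases hC : C ≤ 0
    · have h0 : 0 ≤ (1 / K) ^ θ := by positivity
      have : C * (1 / K) ^ θ ≤ 0 := mul_nonpos_of_nonpos_of_nonneg hC h0
      linarith
    · have hC : 0 < C := lt_of_not_ge hC
      have hM2 : 2 * C / ε ≤ M := le_max_left _ _
      calc C * (1 / K) ^ θ ≤ C * (1 / M) := by gcongr
        _ = C / M := by ring
        _ ≤ C / (2 * C / ε) := by
            apply div_le_div_of_nonneg_left hC.le (by positivity) hM2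
        _ = ε / 2 := by field_simp
  have hev1 := h1 R (ε / 2) (by positivity) K hKpos
  have hsmall : ∀ᶠ δ in 𝓝[>] (0:ℝ), δ ≤ pIK / K := by
    have : Set.Iio (pIK / K) ∈ 𝓝 (0 : ℝ) := by
      apply Iio_mem_nhds; exact div_pos pIK_pos hKpos
    filter_upwards [nhdsWithin_le_nhds this] with δ hδ using (Set.mem_Iio.1 hδ).le
  have hpos : ∀ᶠ δ in 𝓝[>] (0:ℝ), δ ∈ Set.Ioi (0:ℝ) := eventually_mem_nhdsWithin
  filter_upwards [hev1, hev2, hsmall, hpos] with δ h1δ h2δ h3δ h4δ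
  have h4δ : 0 < δ := h4δ
  set p : ℝ := K * δ with hp
  have hppos : 0 < p := mul_pos hKpos h4δ
  have hA := h1δ p hppos.le le_rfl
  have hplo : c₀ * δ ≤ p := by rw [hp]; exact mul_le_mul_of_nonneg_right hc₀le h4δ.le
  have hphi : p ≤ pIK := by
    rw [hp]; rw [le_div_iff₀ hKpos] at h3δ; linarith
  have hB := h2δ p hplo hphi
  have hδp : δ / p = 1 / K := by
    rw [hp]; field_simp
  rw [hδp] at hB
  have hB' : |gaugeCrossingProb pIK R δ - gaugeCrossingProb p R δ| ≤ ε / 2 := hB.trans hCK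
  calc |gaugeCrossingProb pIK R δ - gaugeCrossingProb 0 R δ|
      ≤ |gaugeCrossingProb pIK R δ - gaugeCrossingProb p R δ| +
          |gaugeCrossingProb p R δ - gaugeCrossingProb 0 R δ| := abs_sub_le _ _ _
    _ ≤ ε / 2 + ε / 2 := add_le_add hB' hA
    _ = ε := by ring

/-! ## §2 The crux modulo the two influence bounds -/

/-- THE CRUX MODULO EXACTLY TWO TYPED STATEMENTS.  The summed (dense-window) and dilute-window influence bounds of the
corner seed imply `CardyIKTransport.CornerLineDescent` by name: Russo (`stub_Russo stub_Locality`, landed) turns them into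
uniform corner irrelevance in units of `ξ_p` (`uci_of`) and Regime One (`regimeOne_of`), which overlap (`endgame_core`):
`P_IK(R,δ) − P_0(R,δ) → 0`; the crux's hypothesis (Cardy for `P_IK = gaugeCrossingProb p_IK`, `cornerLineDescent_iff`)
transfers along the vanishing difference to the frozen gauge `p = 0`, and `stub_FreezeToStandard` (landed, unconditional)
carries it to standard bond-`ℤ²`. [folklore] -/
theorem cornerLineDescent_of_influenceBounds :
    (∀ R : ConformalRectangle, ∃ θ C c₀ : ℝ, 0 < θ ∧ 0 < c₀ ∧
      ∀ᶠ δ in 𝓝[>] (0:ℝ), InfluenceBoundOn R θ C c₀ δ) →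
    (∀ (R : ConformalRectangle) (c : ℝ), 0 < c → ∃ C κ : ℝ, 0 < κ ∧
      ∀ᶠ δ in 𝓝[>] (0:ℝ), DiluteBoundOn R c C κ δ) →
    Summit.CriticalPhenomena.CardyFormulaZ2.Theses.CardyIKTransport.CornerLineDescent := by
  intro hsum hdil
  have hrusso := stub_Russo stub_Locality
  rw [cornerLineDescent_iff]
  intro hIK
  apply stub_FreezeToStandard
  intro R φ x hφx
  have hUCI := uci_of hrusso hsum
  have hR1 := regimeOne_of hrusso hdil
  have h1 : Tendsto (gaugeCrossingProb pIK R) (𝓝[>] 0) (𝓝 (cardyFunction (crossRatio x))) :=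
    hIK R φ x hφx
  have h2 : Tendsto (fun δ => gaugeCrossingProb pIK R δ - gaugeCrossingProb 0 R δ) (𝓝[>] 0) (𝓝 0) := by
    rw [Metric.tendsto_nhds]
    intro ε hε
    filter_upwards [endgame_core hR1 hUCI R (ε / 2) (half_pos hε)] with δ hδ
    rw [Real.dist_eq, sub_zero]
    exact lt_of_le_of_lt hδ (half_lt_self hε)
  have h3 := h1.sub h2
  simp only [sub_sub_cancel, sub_zero] at h3
  exact h3

/-- The same, with the two stubs in their REGISTERED form (`ledger skeleton check`, crux stmt-CriticalPhenomena-10964,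
line `symmetric-seed-second-order`): `stub_SummedInfluence` carries the antecedent
`∀ p ∈ (0,1), ∃ C, SyndromeBiasAt p C`, which is the landed theorem `stub_SyndromeBias` (p89215). [folklore] -/
theorem cornerLineDescent_of_registeredStubs :
    ((∀ p : ℝ, 0 < p → p < 1 → ∃ C : ℝ, SyndromeBiasAt p C) →
      ∀ R : ConformalRectangle, ∃ θ C c₀ : ℝ, 0 < θ ∧ 0 < c₀ ∧
        ∀ᶠ δ in 𝓝[>] (0:ℝ), InfluenceBoundOn R θ C c₀ δ) →
    (∀ (R : ConformalRectangle) (c : ℝ), 0 < c → ∃ C κ : ℝ, 0 < κ ∧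
      ∀ᶠ δ in 𝓝[>] (0:ℝ), DiluteBoundOn R c C κ δ) →
    Summit.CriticalPhenomena.CardyFormulaZ2.Theses.CardyIKTransport.CornerLineDescent :=
  fun hsum hdil => cornerLineDescent_of_influenceBounds (hsum stub_SyndromeBias) hdil

end Summit.CriticalPhenomena.CardyFormulaZ2.Theorems.CornerLineDescent.SymmetricSeed
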